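import Literature.Probability.RandomPlanarGeometry.SAWAdsorptionLowTemperatureExact
import Literature.Probability.RandomPlanarGeometry.SAWAdsorptionCriticalFugacityLower
import Literature.Probability.RandomPlanarGeometry.SAWAdsorptionDesorbedLoops
import Mathlib.Analysis.Convex.Deriv
import Mathlib.Analysis.SpecialFunctions.Pow.Real
import Mathlib.Analysis.MeanInequalities
import Mathlib.Analysis.Complex.ExponentialBounds
import HarnessLib

/-!
# The density of wall visits (order parameter) of the adsorbing half-plane self-avoiding walk on `ℤ²`:
# `𝓔_±(a) = a d^±κ/da`, zero below `a_c`, positive above, and `1 − 𝓔_±(a) = 2/a² + 3/a³ + O(a⁻⁴)`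

Topic `Literature/Probability/RandomPlanarGeometry` (continues `SAWAdsorptionFreeEnergyFunction.lean` — `Zd.adsRate a = e^{κ(a)}`,
`Zd.adsFreeEnergy α = κ(α)` (`a = e^α`) convex, monotone, a.e. differentiable, the critical fugacity `Zd.adsCriticalFugacity = a_c`
— and the low-temperature windows of `SAWAdsorptionLowTemperatureSharp/Exact/Series.lean`).

Janse van Rensburg–Whittington 2013 (J. Phys. A 46 435003, arXiv:1307.6457), §3.1 (arXiv v4 pp. 6–9): the mean number of
visits `⟨v⟩_n = a (d/da) log Σ_v l_n(v) a^v` (eq. (3.2)); «Since `n⁻¹ log L_n(a)` is a sequence of convex functions converging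
to a convex limit `κ(a)`, one may interchange the limit and the derivative almost everywhere in
`𝓔(a) = lim n⁻¹⟨v⟩_n = a dκ/da`» (eq. (3.3)); «The left- and right-densities of visits may be defined as
`𝓔_-(a) = a d⁻κ/da`, `𝓔_+(a) = a d⁺κ/da`. These exist for every finite `a > 0` since `κ(a)` is a convex function of
`log a` … `𝓔_-(a) ≤ 𝓔_+(a)` for every `a > 0`. The density of visits, and `𝓔_-(a)` and `𝓔_+(a)` are monotone functions …
Clearly `𝓔(a) = 0` if `a < a_c^o` and `𝓔(a) > 0` for almost all `a > a_c^o`» (eq. (3.4)); Theorem 3 («For almost every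
value of `a > 0`, `lim n⁻¹ v*_n = 𝓔(a)`», p. 7); eq. (3.9) `c^{(d-1)}_{v} l‡_{n-v}(1) a^{v+1} ≤ L_n(a)` (p. 8); Lemma 3 (p. 8)
(`f(x) − log μ_d ≥ (x − log(μ_d/μ_{d-1})) f'(x)`, `f(x) = κ(e^x)`); Theorem 4 (p. 8; the ratio
`(κ(a) − log μ_d)/(log a − log(μ_d/μ_{d-1}))` is non-increasing in `a > μ_d/μ_{d-1}`); Corollary 1 (p. 9: `κ(a) ∼ log μ_{d-1} + log a`).
Here `d = 2`, vertex weights, impenetrable wall `x₀ = 0`, `μ_{d-1} = μ_1 = 1`, and the positive-walk partition function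
`C_n(a) = Z⁺_n(a) = Zd.adsZ n a` (the four limits coincide, `SAWAdsorptionFourLimits.lean`). In the variable `α = log a`,
`𝓔_+(e^α) = d⁺κ/dα`, `𝓔_-(e^α) = d⁻κ/dα`:

* `Zd.meanVisits n a = ⟨v⟩_n`, `Zd.visitDensity n a = n⁻¹⟨v⟩_n ∈ [0, 1]`; the chord (tilting) inequality
  `Zd.rpow_meanVisits_le : (b/a)^{⟨v⟩_n(a)} ≤ Z⁺_n(b)/Z⁺_n(a)` (weighted AM–GM = convexity of `log Z⁺_n(e^α)`);
* `Zd.rightDensity α = d⁺κ/dα`, `Zd.leftDensity α = d⁻κ/dα` (eq. (3.4)): they exist (`hasDerivWithinAt_rightDensity/leftDensity`),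
  `leftDensity ≤ rightDensity`, both monotone, both in `[0, 1]` — the upper bound because **`κ(α) − α` is non-increasing**
  (`Zd.antitone_adsFreeEnergy_sub`, from `Z⁺_n(b)/bⁿ ≤ Z⁺_n(a)/aⁿ` for `a ≤ b`: every walk has at most `n` visits), i.e.
  **`e^{κ(a)}/a` is non-increasing and `κ` is `1`-Lipschitz** (`Zd.lipschitzWith_adsFreeEnergy`);
* **Theorem 3 / eq. (3.3)**: `leftDensity α − ε ≤ visitDensity n (e^α) ≤ rightDensity α + ε` eventually, for every `α` and
  `ε > 0` (`Zd.eventually_visitDensity_le`, `Zd.eventually_le_visitDensity`); hence `visitDensity n (e^α) → κ'(α)` wherever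
  `κ` is differentiable (`Zd.tendsto_visitDensity_of_hasDerivAt`), in particular for a.e. `α` (`Zd.ae_tendsto_visitDensity`);
* **the transition**: `rightDensity α = leftDensity α = 0` and `visitDensity n (e^α) → 0` for `e^α < a_c`; for `e^α > a_c`,
  **`leftDensity α ≥ (κ(α) − log μ)/(α − log a_c) > 0`** (`Zd.div_le_leftDensity`, `Zd.leftDensity_pos`) — positive density for
  EVERY `a > a_c` — with the numeral `𝓔_-(3) ≥ 1/5` (`Zd.one_fifth_le_leftDensity_log_three`);
* **eq. (3.9), d = 2**: `a^{v+2} B_{m}(1) ≤ B_{v+m+4}(a)` (`Zd.pow_mul_Bw_one_le_Bw`); **Lemma 3** for both one-sided derivatives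
  at every `α` (`Zd.rightDensity_mul_sub_le`); **Theorem 4, d = 2**: `(κ(β) − log μ)/(β − log μ) ≤ (κ(α) − log μ)/(α − log μ)` for
  `log μ < α ≤ β` (`Zd.JansevanRensburgWhittington2013_thm4`); **Corollary 1, d = 2** (`Zd.JansevanRensburgWhittington2013_cor1`);
* **low temperature (NEW)**: `1 − 33 e^{−2α} ≤ leftDensity α ≤ rightDensity α ≤ 1 − e^{−2α}/16` (`α ≥ 1/2`, resp. `α ≥ 0`;
  `Zd.one_sub_densities_window`): the desorbed fraction is of order exactly `a⁻²`, and eventually in `n`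
  `1 − 34/a² ≤ n⁻¹⟨v⟩_n(a) ≤ 1 − 1/(17a²)` (`a ≥ 2`); and the SHARP LAW from the tree's window `a + 1/a ≤ e^{κ(a)} ≤ a + 1/a + 6/a²`
  (`SAWAdsorptionLowTemperatureExact.lean`) by chords of length `log(1 + a^{−1/2})`: **`e^{2α}(1 − d^±κ/dα) → 2`**
  (`Zd.tendsto_exp_mul_one_sub_rightDensity/leftDensity`), i.e. **`a²(1 − 𝓔_±(a)) → 2`**
  (`Zd.tendsto_sq_mul_one_sub_rightDensity_log/leftDensity_log`): at low temperature the fraction of monomers off the wall is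
  `2/a² + o(a⁻²)`. (The next term `3/a³` follows in the same way from the Series windows; sequel file.)

Label: CONSOLIDATION (Janse van Rensburg–Whittington 2013 §3.1 for `d = 2`: (3.3), (3.4), Thm 3, (3.9), Lemma 3, Thm 4, Cor. 1 —
all printed for the hypercubic lattice in every `d ≥ 2`; the positivity `𝓔_-(a) > 0` is obtained here for every `a > a_c`, print has
«almost all») + NEW-IN-WRITING modest (the `1`-Lipschitz / antitone facts and the explicit low-temperature law of the order
parameter on `ℤ²`). Axioms: standard throughout, except the one numeral `Zd.one_fifth_le_leftDensity_log_three`, which uses the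
tree's certified `μ(ℤ²) < 2.69` (hence `a_c > 1.066`) and inherits its `native_decide` certificate `checkC_18_2688`.
(Lane «pcv-sawmu», a-p3 g12.)
-/

noncomputable section

open Finset Filter Topology Literature.Probability.LatticeModels SimpleGraph
open scoped BigOperators

namespace Literature.Probability.RandomPlanarGeometry.SAW.Zd

/-! ### Finite volume: the mean number of visits and the chord inequality -/

/-- `Z⁺_n(a) > 0` for `a > 0` (the walk along the wall). [cite: JansevanRensburgWhittington2013, §3.1 eq. (3.2) (arXiv v4 p. 6)] -/
theorem adsZ_pos (n : ℕ) {a : ℝ} (ha : 0 < a) : 0 < adsZ n a :=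
  lt_of_lt_of_le (pow_pos ha n) (pow_le_adsZ n ha.le)

/-- The first moment `Σ_ω v(ω) a^{v(ω)}` of the number of wall visits. [cite: JansevanRensburgWhittington2013, §3.1 eq. (3.2) (arXiv v4 p. 6)] -/
def visitMoment (n : ℕ) (a : ℝ) : ℝ := ∑ ω ∈ hpWalks n, (wallVisits n ω : ℝ) * a ^ wallVisits n ω

/-- **`⟨v⟩_n(a) = Σ_v v Z_n(v) a^v / Σ_v Z_n(v) a^v`**, the mean number of wall visits of the `n`-step positive walk at
fugacity `a`. [cite: JansevanRensburgWhittington2013, §3.1 eq. (3.2) (arXiv v4 p. 6)] -/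
def meanVisits (n : ℕ) (a : ℝ) : ℝ := visitMoment n a / adsZ n a

/-- **`n⁻¹⟨v⟩_n(a)`**, the finite-volume density of visits. [cite: JansevanRensburgWhittington2013, §3.1 eq. (3.3) (arXiv v4 p. 6)] -/
def visitDensity (n : ℕ) (a : ℝ) : ℝ := meanVisits n a / n

/-- `0 ≤ Σ v a^v`. [cite: JansevanRensburgWhittington2013, §3.1 eq. (3.2) (arXiv v4 p. 6)] -/
theorem visitMoment_nonneg (n : ℕ) {a : ℝ} (ha : 0 ≤ a) : 0 ≤ visitMoment n a :=
  Finset.sum_nonneg fun _ _ => mul_nonneg (Nat.cast_nonneg _) (pow_nonneg ha _)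

/-- `Σ v a^v ≤ n Z⁺_n(a)` (at most `n` visits). [cite: JansevanRensburgWhittington2013, §3.1 eq. (3.2) (arXiv v4 p. 6)] -/
theorem visitMoment_le (n : ℕ) {a : ℝ} (ha : 0 ≤ a) : visitMoment n a ≤ n * adsZ n a := by
  rw [visitMoment, adsZ, Finset.mul_sum]
  refine Finset.sum_le_sum fun ω _ => mul_le_mul_of_nonneg_right ?_ (pow_nonneg ha _)
  exact_mod_cast wallVisits_le n ω

/-- `0 ≤ ⟨v⟩_n`. [cite: JansevanRensburgWhittington2013, §3.1 eq. (3.2) (arXiv v4 p. 6)] -/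
theorem meanVisits_nonneg (n : ℕ) {a : ℝ} (ha : 0 < a) : 0 ≤ meanVisits n a :=
  div_nonneg (visitMoment_nonneg n ha.le) (adsZ_pos n ha).le

/-- `⟨v⟩_n ≤ n`. [cite: JansevanRensburgWhittington2013, §3.1 eq. (3.2) (arXiv v4 p. 6)] -/
theorem meanVisits_le (n : ℕ) {a : ℝ} (ha : 0 < a) : meanVisits n a ≤ n :=
  (div_le_iff₀ (adsZ_pos n ha)).2 (visitMoment_le n ha.le)

/-- `0 ≤ n⁻¹⟨v⟩_n`. [cite: JansevanRensburgWhittington2013, §3.1 eq. (3.3) (arXiv v4 p. 6)] -/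
theorem visitDensity_nonneg (n : ℕ) {a : ℝ} (ha : 0 < a) : 0 ≤ visitDensity n a :=
  div_nonneg (meanVisits_nonneg n ha) (Nat.cast_nonneg n)

/-- `n⁻¹⟨v⟩_n ≤ 1`. [cite: JansevanRensburgWhittington2013, §3.1 eq. (3.3) (arXiv v4 p. 6)] -/
theorem visitDensity_le_one (n : ℕ) {a : ℝ} (ha : 0 < a) : visitDensity n a ≤ 1 := by
  unfold visitDensity
  rcases Nat.eq_zero_or_pos n with rfl | hn
  · simp
  · exact (div_le_one (by exact_mod_cast hn)).2 (meanVisits_le n ha)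

/-- **Chord inequality** (weighted AM–GM; the convexity of `α ↦ log Z⁺_n(e^α)` in tangent form):
**`(b/a)^{⟨v⟩_n(a)} ≤ Z⁺_n(b)/Z⁺_n(a)`** for `a, b > 0`. [cite: JansevanRensburgWhittington2013, §3.1 (arXiv v4 p. 6: «n⁻¹ log L_n(a) is a sequence of convex functions»)] -/
theorem rpow_meanVisits_le (n : ℕ) {a b : ℝ} (ha : 0 < a) (hb : 0 < b) :
    (b / a) ^ meanVisits n a ≤ adsZ n b / adsZ n a := by
  have hZ := adsZ_pos n ha
  have hq : 0 < b / a := div_pos hb ha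
  have key := Real.geom_mean_le_arith_mean_weighted (hpWalks n)
    (fun ω => a ^ wallVisits n ω / adsZ n a) (fun ω => (b / a) ^ (wallVisits n ω : ℝ))
    (fun ω _ => div_nonneg (pow_nonneg ha.le _) hZ.le)
    (by rw [← Finset.sum_div, ← adsZ, div_self hZ.ne'])
    (fun ω _ => (Real.rpow_pos_of_pos hq _).le)
  have hL : ∏ ω ∈ hpWalks n, ((b / a) ^ (wallVisits n ω : ℝ)) ^ (a ^ wallVisits n ω / adsZ n a)
      = (b / a) ^ meanVisits n a := by
    rw [meanVisits, visitMoment, Finset.sum_div, Real.rpow_sum_of_pos hq]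
    refine Finset.prod_congr rfl fun ω _ => ?_
    rw [← Real.rpow_mul hq.le, mul_div_assoc]
  have hR : ∑ ω ∈ hpWalks n, a ^ wallVisits n ω / adsZ n a * (b / a) ^ (wallVisits n ω : ℝ)
      = adsZ n b / adsZ n a := by
    rw [adsZ, adsZ, Finset.sum_div]
    refine Finset.sum_congr rfl fun ω _ => ?_
    rw [Real.rpow_natCast, div_mul_eq_mul_div, ← mul_pow, show a * (b / a) = b by field_simp]
  rw [← hL, ← hR]
  exact key

/-- Logarithmic form of the chord inequality: **`⟨v⟩_n(e^α) · (β − α) ≤ log Z⁺_n(e^β) − log Z⁺_n(e^α)`** for all `α, β`.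
[cite: JansevanRensburgWhittington2013, §3.1 (arXiv v4 p. 6: «n⁻¹ log L_n(a) is a sequence of convex functions»)] -/
theorem meanVisits_mul_sub_le (n : ℕ) (α β : ℝ) :
    meanVisits n (Real.exp α) * (β - α) ≤ Real.log (adsZ n (Real.exp β)) - Real.log (adsZ n (Real.exp α)) := by
  have ha := Real.exp_pos α
  have hb := Real.exp_pos β
  have h := rpow_meanVisits_le n ha hb
  have hq : Real.exp β / Real.exp α = Real.exp (β - α) := by rw [Real.exp_sub]
  rw [hq] at h
  have hlog := Real.log_le_log (Real.rpow_pos_of_pos (Real.exp_pos _) _) h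
  rw [Real.log_rpow (Real.exp_pos _), Real.log_exp, Real.log_div (adsZ_pos n hb).ne' (adsZ_pos n ha).ne'] at hlog
  linarith

/-- `n⁻¹ log Z⁺_n(e^α)`, the finite-volume free energy. [cite: JansevanRensburgWhittington2013, §3.1 (arXiv v4 p. 6)] -/
def finFreeEnergy (n : ℕ) (α : ℝ) : ℝ := Real.log (adsZ n (Real.exp α)) / n

/-- **Density sandwich, finite `n`**: for `h > 0`, `visitDensity n (e^α) ≤ (κ_n(α+h) − κ_n(α))/h`.
[cite: JansevanRensburgWhittington2013, §3.1 eq. (3.3) (arXiv v4 p. 6)] -/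
theorem visitDensity_le_slope (n : ℕ) (α : ℝ) {h : ℝ} (hh : 0 < h) :
    visitDensity n (Real.exp α) ≤ (finFreeEnergy n (α + h) - finFreeEnergy n α) / h := by
  rcases Nat.eq_zero_or_pos n with rfl | hn
  · simp [visitDensity, finFreeEnergy]
  have hn' : (0 : ℝ) < n := by exact_mod_cast hn
  have key := meanVisits_mul_sub_le n α (α + h)
  rw [add_sub_cancel_left] at key
  rw [visitDensity, finFreeEnergy, finFreeEnergy, ← sub_div, div_div, le_div_iff₀ (by positivity)]
  calc meanVisits n (Real.exp α) / n * (n * h) = meanVisits n (Real.exp α) * h := by field_simp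
    _ ≤ _ := key

/-- **Density sandwich, finite `n`**: for `h > 0`, `(κ_n(α) − κ_n(α−h))/h ≤ visitDensity n (e^α)`.
[cite: JansevanRensburgWhittington2013, §3.1 eq. (3.3) (arXiv v4 p. 6)] -/
theorem slope_le_visitDensity (n : ℕ) (α : ℝ) {h : ℝ} (hh : 0 < h) (hn : 0 < n) :
    (finFreeEnergy n α - finFreeEnergy n (α - h)) / h ≤ visitDensity n (Real.exp α) := by
  have hn' : (0 : ℝ) < n := by exact_mod_cast hn
  have key := meanVisits_mul_sub_le n α (α - h)
  rw [sub_sub_cancel_left, mul_neg] at key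
  rw [visitDensity, finFreeEnergy, finFreeEnergy, ← sub_div, div_div, div_le_iff₀ (by positivity)]
  calc Real.log (adsZ n (Real.exp α)) - Real.log (adsZ n (Real.exp (α - h)))
      ≤ meanVisits n (Real.exp α) * h := by linarith
    _ = meanVisits n (Real.exp α) / n * (n * h) := by field_simp

/-- **`n⁻¹ log Z⁺_n(e^α) → κ(α)`**. [cite: JansevanRensburgWhittington2013, §3.1 (arXiv v4 p. 6: «converging to a convex limit κ(a)»)] -/
theorem tendsto_finFreeEnergy (α : ℝ) : Tendsto (fun n => finFreeEnergy n α) atTop (𝓝 (adsFreeEnergy α)) := by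
  have ha := Real.exp_pos α
  have hR := adsRate_pos ha.le
  have h := (tendsto_adsRate ha.le)
  have hlog := (Real.continuousAt_log hR.ne').tendsto.comp h
  refine (hlog.congr' ?_)
  filter_upwards [eventually_gt_atTop 0] with n hn
  simp only [Function.comp, finFreeEnergy]
  rw [Real.log_rpow (adsZ_pos n ha), one_div, inv_mul_eq_div]

/-! ### `κ(α) − α` is non-increasing: `e^{κ(a)}/a` decreases, `κ` is `1`-Lipschitz -/

/-- **`Z⁺_n(b)/bⁿ ≤ Z⁺_n(a)/aⁿ` for `0 < a ≤ b`**: every term is `(v ≤ n)` `a^{v-n}`, non-increasing in `a`.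
[cite: JansevanRensburgWhittington2013, §3.1 eq. (3.5) (arXiv v4 p. 6: «κ(a) = sup_{α∈[0,1]} {log 𝓟(α) + α log a}» — a supremum of affine functions of log a with slopes in [0,1])] -/
theorem adsZ_div_pow_le (n : ℕ) {a b : ℝ} (ha : 0 < a) (hab : a ≤ b) : adsZ n b / b ^ n ≤ adsZ n a / a ^ n := by
  have hb : 0 < b := ha.trans_le hab
  rw [adsZ, adsZ, Finset.sum_div, Finset.sum_div]
  refine Finset.sum_le_sum fun ω _ => ?_
  set v := wallVisits n ω with hv_def
  have hv : v ≤ n := wallVisits_le n ω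
  rw [div_le_div_iff₀ (pow_pos hb n) (pow_pos ha n)]
  obtain ⟨k, hk⟩ := Nat.exists_eq_add_of_le hv
  have ea : a ^ n = a ^ v * a ^ k := by rw [← pow_add, ← hk]
  have eb : b ^ n = b ^ v * b ^ k := by rw [← pow_add, ← hk]
  rw [ea, eb]
  have h1 : b ^ v * a ^ v * a ^ k ≤ b ^ v * a ^ v * b ^ k :=
    mul_le_mul_of_nonneg_left (pow_le_pow_left₀ ha.le hab k) (by positivity)
  calc b ^ v * (a ^ v * a ^ k) = b ^ v * a ^ v * a ^ k := by ring
    _ ≤ b ^ v * a ^ v * b ^ k := h1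
    _ = a ^ v * (b ^ v * b ^ k) := by ring

/-- **`e^{κ(b)}/b ≤ e^{κ(a)}/a` for `0 < a ≤ b`**: the free energy per unit of `log a` never gains more than `1`.
[cite: JansevanRensburgWhittington2013, §3.1 eq. (3.5) (arXiv v4 p. 6: «κ(a) = sup_{α∈[0,1]} {log 𝓟(α) + α log a}» — a supremum of affine functions of log a with slopes in [0,1])] -/
theorem adsRate_div_le {a b : ℝ} (ha : 0 < a) (hab : a ≤ b) : adsRate b / b ≤ adsRate a / a := by
  have hb : 0 < b := ha.trans_le hab
  have hA := (tendsto_adsRate ha.le).comp (tendsto_add_atTop_nat 1)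
  have hB := (tendsto_adsRate hb.le).comp (tendsto_add_atTop_nat 1)
  have hA' : Tendsto (fun n : ℕ => (adsZ (n + 1) a) ^ (1 / ((n + 1 : ℕ) : ℝ)) / a) atTop (𝓝 (adsRate a / a)) :=
    hA.div_const a
  have hB' : Tendsto (fun n : ℕ => (adsZ (n + 1) b) ^ (1 / ((n + 1 : ℕ) : ℝ)) / b) atTop (𝓝 (adsRate b / b)) :=
    hB.div_const b
  refine le_of_tendsto_of_tendsto' hB' hA' fun n => ?_
  have hn : n + 1 ≠ 0 := Nat.succ_ne_zero n
  have hn0 : (0 : ℝ) < 1 / ((n + 1 : ℕ) : ℝ) := by positivity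
  have ea : (adsZ (n + 1) a) ^ (1 / ((n + 1 : ℕ) : ℝ)) / a = (adsZ (n + 1) a / a ^ (n + 1)) ^ (1 / ((n + 1 : ℕ) : ℝ)) := by
    rw [Real.div_rpow (adsZ_pos _ ha).le (pow_nonneg ha.le _), one_div, Real.pow_rpow_inv_natCast ha.le hn]
  have eb : (adsZ (n + 1) b) ^ (1 / ((n + 1 : ℕ) : ℝ)) / b = (adsZ (n + 1) b / b ^ (n + 1)) ^ (1 / ((n + 1 : ℕ) : ℝ)) := by
    rw [Real.div_rpow (adsZ_pos _ hb).le (pow_nonneg hb.le _), one_div, Real.pow_rpow_inv_natCast hb.le hn]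
  rw [ea, eb]
  exact Real.rpow_le_rpow (div_nonneg (adsZ_pos _ hb).le (pow_nonneg hb.le _)) (adsZ_div_pow_le _ ha hab) hn0.le

/-- **`κ(α) − α` is non-increasing in `α`.** [cite: JansevanRensburgWhittington2013, §3.1 eq. (3.5) (arXiv v4 p. 6: «κ(a) = sup_{α∈[0,1]} {log 𝓟(α) + α log a}» — a supremum of affine functions of log a with slopes in [0,1])] -/
theorem antitone_adsFreeEnergy_sub : Antitone fun α => adsFreeEnergy α - α := by
  intro α β hαβ
  have ha := Real.exp_pos α
  have hb := Real.exp_pos β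
  have h := adsRate_div_le ha (Real.exp_le_exp.2 hαβ)
  have hl := Real.log_le_log (div_pos (adsRate_pos hb.le) hb) h
  rw [Real.log_div (adsRate_pos hb.le).ne' hb.ne', Real.log_div (adsRate_pos ha.le).ne' ha.ne', Real.log_exp,
    Real.log_exp] at hl
  simpa [adsFreeEnergy] using hl

/-- **`0 ≤ κ(β) − κ(α) ≤ β − α` for `α ≤ β`**. [cite: JansevanRensburgWhittington2013, §3.1 eq. (3.5) (arXiv v4 p. 6: «κ(a) = sup_{α∈[0,1]} {log 𝓟(α) + α log a}» — a supremum of affine functions of log a with slopes in [0,1])] -/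
theorem adsFreeEnergy_sub_mem_Icc_of_le {α β : ℝ} (h : α ≤ β) :
    adsFreeEnergy β - adsFreeEnergy α ∈ Set.Icc 0 (β - α) := by
  refine ⟨sub_nonneg.2 (monotone_adsFreeEnergy h), ?_⟩
  have := antitone_adsFreeEnergy_sub h
  simp only at this
  linarith

/-- **`κ` is `1`-Lipschitz.** [cite: JansevanRensburgWhittington2013, §3.1 eq. (3.5) (arXiv v4 p. 6: «κ(a) = sup_{α∈[0,1]} {log 𝓟(α) + α log a}» — a supremum of affine functions of log a with slopes in [0,1])] -/
theorem lipschitzWith_adsFreeEnergy : LipschitzWith 1 adsFreeEnergy := by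
  refine LipschitzWith.of_dist_le_mul fun α β => ?_
  rw [NNReal.coe_one, one_mul, Real.dist_eq, Real.dist_eq]
  rcases le_total α β with h | h
  · obtain ⟨h0, h1⟩ := adsFreeEnergy_sub_mem_Icc_of_le h
    rw [abs_sub_comm, abs_of_nonneg h0, abs_sub_comm, abs_of_nonneg (sub_nonneg.2 h)]
    exact h1
  · obtain ⟨h0, h1⟩ := adsFreeEnergy_sub_mem_Icc_of_le h
    rw [abs_of_nonneg h0, abs_of_nonneg (sub_nonneg.2 h)]
    exact h1

/-- **Slopes of `κ` lie in `[0, 1]`.** [cite: JansevanRensburgWhittington2013, §3.1 eq. (3.5) (arXiv v4 p. 6: «κ(a) = sup_{α∈[0,1]} {log 𝓟(α) + α log a}» — a supremum of affine functions of log a with slopes in [0,1])] -/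
theorem slope_adsFreeEnergy_mem_Icc {α β : ℝ} (h : α < β) : slope adsFreeEnergy α β ∈ Set.Icc (0 : ℝ) 1 := by
  have hm := adsFreeEnergy_sub_mem_Icc_of_le h.le
  rw [slope_def_field]
  exact ⟨div_nonneg hm.1 (sub_pos.2 h).le, (div_le_one (sub_pos.2 h)).2 hm.2⟩

/-! ### The one-sided densities `𝓔_±` (eq. (3.4)) -/

/-- **`𝓔_+(e^α) = d⁺κ/dα`**, the right-density of visits (right derivative of the convex `κ`).
[cite: JansevanRensburgWhittington2013, §3.1 eq. (3.4) (arXiv v4 p. 6)] -/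
def rightDensity (α : ℝ) : ℝ := derivWithin adsFreeEnergy (Set.Ioi α) α

/-- **`𝓔_-(e^α) = d⁻κ/dα`**, the left-density of visits. [cite: JansevanRensburgWhittington2013, §3.1 eq. (3.4) (arXiv v4 p. 6)] -/
def leftDensity (α : ℝ) : ℝ := derivWithin adsFreeEnergy (Set.Iio α) α

/-- Every point is interior to `univ` (the domain of convexity of `κ`). [folklore] -/
private theorem mem_interior_univ (α : ℝ) : α ∈ interior (Set.univ : Set ℝ) := by simp

/-- **«These exist for every finite `a > 0` since `κ(a)` is a convex function of `log a`»** (right derivative).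
[cite: JansevanRensburgWhittington2013, §3.1 eq. (3.4) (arXiv v4 p. 6)] -/
theorem hasDerivWithinAt_rightDensity (α : ℝ) :
    HasDerivWithinAt adsFreeEnergy (rightDensity α) (Set.Ioi α) α :=
  convexOn_adsFreeEnergy.hasDerivWithinAt_rightDeriv_of_mem_interior (mem_interior_univ α)

/-- **«These exist for every finite `a > 0`»** (left derivative). [cite: JansevanRensburgWhittington2013, §3.1 eq. (3.4) (arXiv v4 p. 6)] -/
theorem hasDerivWithinAt_leftDensity (α : ℝ) :
    HasDerivWithinAt adsFreeEnergy (leftDensity α) (Set.Iio α) α :=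
  convexOn_adsFreeEnergy.hasDerivWithinAt_leftDeriv_of_mem_interior (mem_interior_univ α)

/-- **«`𝓔_-(a) ≤ 𝓔_+(a)` for every `a > 0`»**. [cite: JansevanRensburgWhittington2013, §3.1 eq. (3.4) (arXiv v4 p. 6)] -/
theorem leftDensity_le_rightDensity (α : ℝ) : leftDensity α ≤ rightDensity α :=
  convexOn_adsFreeEnergy.leftDeriv_le_rightDeriv_of_mem_interior (mem_interior_univ α)

/-- **«`𝓔_-(a)` and `𝓔_+(a)` are monotone functions»** (right). [cite: JansevanRensburgWhittington2013, §3.1 (arXiv v4 p. 6)] -/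
theorem monotone_rightDensity : Monotone rightDensity := by
  intro α β h
  have := convexOn_adsFreeEnergy.monotoneOn_rightDeriv (mem_interior_univ α) (mem_interior_univ β) h
  simpa [rightDensity] using this

/-- **«`𝓔_-(a)` and `𝓔_+(a)` are monotone functions»** (left). [cite: JansevanRensburgWhittington2013, §3.1 (arXiv v4 p. 6)] -/
theorem monotone_leftDensity : Monotone leftDensity := by
  intro α β h
  have := convexOn_adsFreeEnergy.monotoneOn_leftDeriv (mem_interior_univ α) (mem_interior_univ β) h
  simpa [leftDensity] using this

/-- `d⁺κ/dα(α) ≤ (κ(β) − κ(α))/(β − α)` for `α < β`. [cite: JansevanRensburgWhittington2013, §3.1 (arXiv v4 p. 6: convexity of κ)] -/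
theorem rightDensity_le_slope {α β : ℝ} (h : α < β) : rightDensity α ≤ slope adsFreeEnergy α β :=
  convexOn_adsFreeEnergy.rightDeriv_le_slope_of_mem_interior (mem_interior_univ α) (Set.mem_univ β) h

/-- `(κ(β) − κ(α))/(β − α) ≤ d⁻κ/dα(β)` for `α < β`. [cite: JansevanRensburgWhittington2013, §3.1 (arXiv v4 p. 6: convexity of κ)] -/
theorem slope_le_leftDensity {α β : ℝ} (h : α < β) : slope adsFreeEnergy α β ≤ leftDensity β :=
  convexOn_adsFreeEnergy.slope_le_leftDeriv_of_mem_interior (Set.mem_univ α) (mem_interior_univ β) h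

/-- `d⁺κ/dα(α) ≤ d⁻κ/dα(β)` for `α < β` (the one-sided derivatives interlace). [cite: JansevanRensburgWhittington2013, §3.1 (arXiv v4 p. 6)] -/
theorem rightDensity_le_leftDensity_of_lt {α β : ℝ} (h : α < β) : rightDensity α ≤ leftDensity β :=
  (rightDensity_le_slope h).trans (slope_le_leftDensity h)

/-- **`0 ≤ 𝓔_-`**. [cite: JansevanRensburgWhittington2013, §3.1 eq. (3.4) (arXiv v4 p. 6)] -/
theorem leftDensity_nonneg (α : ℝ) : 0 ≤ leftDensity α :=
  (slope_adsFreeEnergy_mem_Icc (sub_one_lt α)).1.trans (slope_le_leftDensity (sub_one_lt α))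

/-- **`𝓔_+ ≤ 1`** (a density). [cite: JansevanRensburgWhittington2013, §3.1 eq. (3.5) (arXiv v4 p. 6: «α ∈ [0,1]»)] -/
theorem rightDensity_le_one (α : ℝ) : rightDensity α ≤ 1 :=
  (rightDensity_le_slope (lt_add_one α)).trans (slope_adsFreeEnergy_mem_Icc (lt_add_one α)).2

/-- **`0 ≤ 𝓔_-(a) ≤ 𝓔_+(a) ≤ 1`**. [cite: JansevanRensburgWhittington2013, §3.1 eq. (3.4)–(3.5) (arXiv v4 p. 6)] -/
theorem densities_mem_Icc (α : ℝ) :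
    0 ≤ leftDensity α ∧ leftDensity α ≤ rightDensity α ∧ rightDensity α ≤ 1 :=
  ⟨leftDensity_nonneg α, leftDensity_le_rightDensity α, rightDensity_le_one α⟩

/-! ### Theorem 3 / eq. (3.3): the finite-volume density converges to `κ'` wherever `κ` is differentiable -/

/-- For `h, ε > 0`: eventually `visitDensity n (e^α) ≤ (κ(α+h) − κ(α))/h + ε`.
[cite: JansevanRensburgWhittington2013, §3.1 eq. (3.3) (arXiv v4 p. 6: «one may interchange the limit and the derivative almost everywhere»)] -/
theorem eventually_visitDensity_le_slope (α : ℝ) {h ε : ℝ} (hh : 0 < h) (hε : 0 < ε) :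
    ∀ᶠ n : ℕ in atTop, visitDensity n (Real.exp α) ≤ slope adsFreeEnergy α (α + h) + ε := by
  have h3 : Tendsto (fun n => (finFreeEnergy n (α + h) - finFreeEnergy n α) / h) atTop
      (𝓝 ((adsFreeEnergy (α + h) - adsFreeEnergy α) / h)) :=
    ((tendsto_finFreeEnergy (α + h)).sub (tendsto_finFreeEnergy α)).div_const h
  have hslope : slope adsFreeEnergy α (α + h) = (adsFreeEnergy (α + h) - adsFreeEnergy α) / h := by
    rw [slope_def_field, add_sub_cancel_left]
  rw [hslope]
  filter_upwards [h3.eventually (eventually_lt_nhds (lt_add_of_pos_right _ hε))] with n hn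
  exact (visitDensity_le_slope n α hh).trans hn.le

/-- For `h, ε > 0`: eventually `(κ(α) − κ(α−h))/h − ε ≤ visitDensity n (e^α)`.
[cite: JansevanRensburgWhittington2013, §3.1 eq. (3.3) (arXiv v4 p. 6)] -/
theorem eventually_slope_le_visitDensity (α : ℝ) {h ε : ℝ} (hh : 0 < h) (hε : 0 < ε) :
    ∀ᶠ n : ℕ in atTop, slope adsFreeEnergy (α - h) α - ε ≤ visitDensity n (Real.exp α) := by
  have h3 : Tendsto (fun n => (finFreeEnergy n α - finFreeEnergy n (α - h)) / h) atTop
      (𝓝 ((adsFreeEnergy α - adsFreeEnergy (α - h)) / h)) :=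
    ((tendsto_finFreeEnergy α).sub (tendsto_finFreeEnergy (α - h))).div_const h
  have hslope : slope adsFreeEnergy (α - h) α = (adsFreeEnergy α - adsFreeEnergy (α - h)) / h := by
    rw [slope_def_field, sub_sub_cancel]
  rw [hslope]
  filter_upwards [h3.eventually (eventually_gt_nhds (sub_lt_self _ hε)), eventually_gt_atTop 0] with n hn hn0
  exact hn.le.trans (slope_le_visitDensity n α hh hn0)

/-- **`limsup_n n⁻¹⟨v⟩_n(e^α) ≤ 𝓔_+`**: for every `ε > 0`, eventually `visitDensity n (e^α) ≤ d⁺κ/dα + ε`.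
[cite: JansevanRensburgWhittington2013, §3.1 eq. (3.3)–(3.4) (arXiv v4 p. 6)] -/
theorem eventually_visitDensity_le (α : ℝ) {ε : ℝ} (hε : 0 < ε) :
    ∀ᶠ n : ℕ in atTop, visitDensity n (Real.exp α) ≤ rightDensity α + ε := by
  have ht : Tendsto (slope adsFreeEnergy α) (𝓝[>] α) (𝓝 (rightDensity α)) :=
    (hasDerivWithinAt_iff_tendsto_slope' Set.self_notMem_Ioi).1 (hasDerivWithinAt_rightDensity α)
  have h1 : ∀ᶠ y in 𝓝[>] α, slope adsFreeEnergy α y < rightDensity α + ε / 2 :=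
    ht.eventually (eventually_lt_nhds (by linarith))
  have h2 : ∀ᶠ y in 𝓝[>] α, α < y := self_mem_nhdsWithin
  obtain ⟨y, hy1, hy2⟩ := (h1.and h2).exists
  have hh : 0 < y - α := sub_pos.2 hy2
  filter_upwards [eventually_visitDensity_le_slope α hh (half_pos hε)] with n hn
  rw [add_sub_cancel] at hn
  linarith

/-- **`𝓔_- ≤ liminf_n n⁻¹⟨v⟩_n(e^α)`**: for every `ε > 0`, eventually `d⁻κ/dα − ε ≤ visitDensity n (e^α)`.
[cite: JansevanRensburgWhittington2013, §3.1 eq. (3.3)–(3.4) (arXiv v4 p. 6)] -/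
theorem eventually_le_visitDensity (α : ℝ) {ε : ℝ} (hε : 0 < ε) :
    ∀ᶠ n : ℕ in atTop, leftDensity α - ε ≤ visitDensity n (Real.exp α) := by
  have ht : Tendsto (slope adsFreeEnergy α) (𝓝[<] α) (𝓝 (leftDensity α)) :=
    (hasDerivWithinAt_iff_tendsto_slope' Set.self_notMem_Iio).1 (hasDerivWithinAt_leftDensity α)
  have h1 : ∀ᶠ y in 𝓝[<] α, leftDensity α - ε / 2 < slope adsFreeEnergy α y :=
    ht.eventually (eventually_gt_nhds (by linarith))
  have h2 : ∀ᶠ y in 𝓝[<] α, y < α := self_mem_nhdsWithin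
  obtain ⟨y, hy1, hy2⟩ := (h1.and h2).exists
  have hh : 0 < α - y := sub_pos.2 hy2
  filter_upwards [eventually_slope_le_visitDensity α hh (half_pos hε)] with n hn
  rw [sub_sub_cancel, slope_comm] at hn
  linarith

/-- If `𝓔_-(e^α) = 𝓔_+(e^α) = d` then `n⁻¹⟨v⟩_n(e^α) → d`. [cite: JansevanRensburgWhittington2013, §3.1 Theorem 3 (arXiv v4 p. 7)] -/
theorem tendsto_visitDensity_of_eq {α d : ℝ} (hl : leftDensity α = d) (hr : rightDensity α = d) :
    Tendsto (fun n : ℕ => visitDensity n (Real.exp α)) atTop (𝓝 d) := by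
  rw [tendsto_order]
  refine ⟨fun b hb => ?_, fun b hb => ?_⟩
  · filter_upwards [eventually_le_visitDensity α (half_pos (sub_pos.2 hb))] with n hn
    rw [hl] at hn; linarith
  · filter_upwards [eventually_visitDensity_le α (half_pos (sub_pos.2 hb))] with n hn
    rw [hr] at hn; linarith

/-- **Eq. (3.3): `lim n⁻¹⟨v⟩_n = dκ/dα` wherever `κ` is differentiable.**
[cite: JansevanRensburgWhittington2013, §3.1 eq. (3.3) and Theorem 3 (arXiv v4 pp. 6–7)] -/
theorem tendsto_visitDensity_of_hasDerivAt {α d : ℝ} (h : HasDerivAt adsFreeEnergy d α) :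
    Tendsto (fun n : ℕ => visitDensity n (Real.exp α)) atTop (𝓝 d) := by
  refine tendsto_visitDensity_of_eq ?_ ?_
  · exact (h.hasDerivWithinAt (s := Set.Iio α)).derivWithin (uniqueDiffWithinAt_Iio α)
  · exact (h.hasDerivWithinAt (s := Set.Ioi α)).derivWithin (uniqueDiffWithinAt_Ioi α)

/-- **Theorem 3: for almost every `α`, `n⁻¹⟨v⟩_n(e^α) → κ'(α)`** («For almost every value of `a > 0`,
`lim n⁻¹ v*_n = 𝓔(a)`»; here with `⟨v⟩_n` itself). [cite: JansevanRensburgWhittington2013, §3.1 Theorem 3 (arXiv v4 p. 7)] -/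
theorem ae_tendsto_visitDensity :
    ∀ᵐ α : ℝ, Tendsto (fun n : ℕ => visitDensity n (Real.exp α)) atTop (𝓝 (deriv adsFreeEnergy α)) := by
  filter_upwards [ae_differentiableAt_adsFreeEnergy] with α hα
  exact tendsto_visitDensity_of_hasDerivAt hα.hasDerivAt

/-! ### The transition: zero density below `a_c`, positive density above -/

/-- `κ(α) = log μ` for `e^α < a_c`. [cite: JansevanRensburgWhittington2013, §3.1 Theorem 5 (arXiv v4 p. 9: «For a < a_c^o, κ(a) = log μ_d»)] -/
theorem adsFreeEnergy_eq_of_exp_lt {α : ℝ} (h : Real.exp α < adsCriticalFugacity) :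
    adsFreeEnergy α = Real.log (connectiveConstant 2) := by
  rw [adsFreeEnergy, adsRate_eq_of_lt_adsCriticalFugacity (Real.exp_pos α).le h]

/-- **«Clearly `𝓔(a) = 0` if `a < a_c^o`»** — right density. [cite: JansevanRensburgWhittington2013, §3.1 (arXiv v4 p. 6)] -/
theorem rightDensity_eq_zero_of_exp_lt {α : ℝ} (h : Real.exp α < adsCriticalFugacity) : rightDensity α = 0 := by
  have hac : 0 < adsCriticalFugacity := zero_lt_one.trans_le one_le_adsCriticalFugacity
  have hα : α < Real.log adsCriticalFugacity := by rwa [Real.lt_log_iff_exp_lt hac]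
  set β := (α + Real.log adsCriticalFugacity) / 2 with hβ
  have hαβ : α < β := by rw [hβ]; linarith
  have hβc : Real.exp β < adsCriticalFugacity := by
    rw [← Real.lt_log_iff_exp_lt hac, hβ]; linarith
  have hs : slope adsFreeEnergy α β = 0 := by
    rw [slope_def_field, adsFreeEnergy_eq_of_exp_lt h, adsFreeEnergy_eq_of_exp_lt hβc, sub_self, zero_div]
  exact le_antisymm ((rightDensity_le_slope hαβ).trans hs.le) ((leftDensity_nonneg α).trans (leftDensity_le_rightDensity α))

/-- **«Clearly `𝓔(a) = 0` if `a < a_c^o`»** — left density. [cite: JansevanRensburgWhittington2013, §3.1 (arXiv v4 p. 6)] -/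
theorem leftDensity_eq_zero_of_exp_lt {α : ℝ} (h : Real.exp α < adsCriticalFugacity) : leftDensity α = 0 :=
  le_antisymm ((leftDensity_le_rightDensity α).trans (rightDensity_eq_zero_of_exp_lt h).le) (leftDensity_nonneg α)

/-- **Zero density of visits in the desorbed phase: `n⁻¹⟨v⟩_n(a) → 0` for `0 < a < a_c`.**
[cite: JansevanRensburgWhittington2013, §3.1 (arXiv v4 p. 6: «𝓔(a) = 0 if a < a_c^o»)] -/
theorem tendsto_visitDensity_zero_of_lt {a : ℝ} (ha : 0 < a) (h : a < adsCriticalFugacity) :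
    Tendsto (fun n : ℕ => visitDensity n a) atTop (𝓝 0) := by
  have h' : Real.exp (Real.log a) < adsCriticalFugacity := by rwa [Real.exp_log ha]
  have := tendsto_visitDensity_of_eq (leftDensity_eq_zero_of_exp_lt h') (rightDensity_eq_zero_of_exp_lt h')
  rwa [Real.exp_log ha] at this

/-- **`(κ(α) − log μ)/(α − log a_c) ≤ 𝓔_-(e^α)` for `e^α > a_c`** (the chord from `(log a_c, log μ)`).
[cite: JansevanRensburgWhittington2013, §3.1 (arXiv v4 pp. 6, 9: «𝓔(a) > 0 for almost all a > a_c^o»; «E(a) becomes strictly positive»)] -/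
theorem div_le_leftDensity {α : ℝ} (h : Real.log adsCriticalFugacity < α) :
    (adsFreeEnergy α - Real.log (connectiveConstant 2)) / (α - Real.log adsCriticalFugacity) ≤ leftDensity α := by
  have hs := slope_le_leftDensity h
  rwa [slope_def_field, adsFreeEnergy_log_adsCriticalFugacity] at hs

/-- **Positive density of visits for EVERY `a > a_c`: `0 < 𝓔_-(e^α)` for `e^α > a_c`** (print: «for almost all»).
[cite: JansevanRensburgWhittington2013, §3.1 (arXiv v4 pp. 6, 9: «𝓔(a) > 0 for almost all a > a_c^o»; «E(a) becomes strictly positive»)] -/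
theorem leftDensity_pos {α : ℝ} (h : Real.log adsCriticalFugacity < α) : 0 < leftDensity α := by
  have hac : 0 < adsCriticalFugacity := zero_lt_one.trans_le one_le_adsCriticalFugacity
  have hα : adsCriticalFugacity < Real.exp α := by rwa [Real.log_lt_iff_lt_exp hac] at h
  have hnum : 0 < adsFreeEnergy α - Real.log (connectiveConstant 2) := by
    rw [sub_pos, adsFreeEnergy]
    exact Real.log_lt_log (connectiveConstant_pos 2) (connectiveConstant_lt_adsRate_of_adsCriticalFugacity_lt hα)
  exact lt_of_lt_of_le (div_pos hnum (sub_pos.2 h)) (div_le_leftDensity h)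

/-- **Eventually a positive fraction of the walk is adsorbed, for every `a > a_c`**:
`(κ(log a) − log μ)/(2(log a − log a_c)) ≤ n⁻¹⟨v⟩_n(a)` for all large `n`.
[cite: JansevanRensburgWhittington2013, §3.1 Theorem 3 (arXiv v4 p. 7: «v*_n → ∞ as n → ∞ if a > a_c^o»)] -/
theorem eventually_le_visitDensity_of_gt {a : ℝ} (h : adsCriticalFugacity < a) :
    ∀ᶠ n : ℕ in atTop, (adsFreeEnergy (Real.log a) - Real.log (connectiveConstant 2)) /
      (2 * (Real.log a - Real.log adsCriticalFugacity)) ≤ visitDensity n a := by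
  have hac : 0 < adsCriticalFugacity := zero_lt_one.trans_le one_le_adsCriticalFugacity
  have ha : 0 < a := hac.trans h
  have hα : Real.log adsCriticalFugacity < Real.log a := Real.log_lt_log hac h
  set q := (adsFreeEnergy (Real.log a) - Real.log (connectiveConstant 2)) / (Real.log a - Real.log adsCriticalFugacity)
  have hq : 0 < q := lt_of_lt_of_le (by
    have := leftDensity_pos hα
    have h2 := div_le_leftDensity hα
    exact lt_of_lt_of_le (div_pos (by
      rw [sub_pos, adsFreeEnergy, Real.exp_log ha]
      exact Real.log_lt_log (connectiveConstant_pos 2) (connectiveConstant_lt_adsRate_of_adsCriticalFugacity_lt h))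
      (sub_pos.2 hα)) le_rfl) le_rfl
  have hev := eventually_le_visitDensity (Real.log a) (half_pos hq)
  rw [Real.exp_log ha] at hev
  filter_upwards [hev] with n hn
  have h2 := div_le_leftDensity hα
  have e : (adsFreeEnergy (Real.log a) - Real.log (connectiveConstant 2)) /
      (2 * (Real.log a - Real.log adsCriticalFugacity)) = q / 2 := by
    rw [mul_comm, ← div_div]
  rw [e]
  linarith

/-- **Numeral: `𝓔_-(3) ≥ 1/5`** — at fugacity `a = 3` at least a fifth of the monomers lie in the surface, eventually
(`κ(log 3) ≥ log(3 + 1/3)`, `μ < 2.69`, `a_c > 1.066`). [cite: JansevanRensburgWhittington2013, §3.1 (arXiv v4 p. 9: «E(a) becomes strictly positive»)] -/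
theorem one_fifth_le_leftDensity_log_three : (1 : ℝ) / 5 ≤ leftDensity (Real.log 3) := by
  have hac : 0 < adsCriticalFugacity := zero_lt_one.trans_le one_le_adsCriticalFugacity
  have hc3 : adsCriticalFugacity < 3 :=
    lt_of_le_of_lt adsCriticalFugacity_le_connectiveConstant (connectiveConstant_two_lt_269.trans (by norm_num))
  have hα : Real.log adsCriticalFugacity < Real.log 3 := Real.log_lt_log hac hc3
  refine le_trans ?_ (div_le_leftDensity hα)
  have hκ : Real.log (10 / 3) ≤ adsFreeEnergy (Real.log 3) := by
    rw [adsFreeEnergy, Real.exp_log (by norm_num : (0 : ℝ) < 3)]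
    have h := add_inv_le_adsRate (le_refl (3 : ℝ))
    exact Real.log_le_log (by norm_num) (by norm_num at h ⊢; linarith)
  have hμ : Real.log (connectiveConstant 2) < Real.log (269 / 100) :=
    Real.log_lt_log (connectiveConstant_pos 2) connectiveConstant_two_lt_269
  have hc : Real.log (1066 / 1000) < Real.log adsCriticalFugacity :=
    Real.log_lt_log (by norm_num) adsCriticalFugacity_gt
  have hden : 0 < Real.log 3 - Real.log adsCriticalFugacity := sub_pos.2 hα
  rw [le_div_iff₀ hden]
  -- `(log 3 − log 1.066)/5 ≤ log(10/3) − log 2.69`, i.e. `(3000/1066) ≤ (1000/807)^5`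
  have key : (Real.log 3 - Real.log (1066 / 1000)) ≤ 5 * (Real.log (10 / 3) - Real.log (269 / 100)) := by
    rw [← Real.log_div (by norm_num) (by norm_num), ← Real.log_div (by norm_num) (by norm_num)]
    have e : (5 : ℝ) * Real.log (10 / 3 / (269 / 100)) = Real.log ((10 / 3 / (269 / 100)) ^ 5) := by
      rw [Real.log_pow]; norm_num
    rw [e]
    exact Real.log_le_log (by norm_num) (by norm_num)
  linarith

/-! ### Eq. (3.9) for `d = 2`, Lemma 3, Theorem 4 and Corollary 1 -/

/-- The walk along the wall: **`aⁿ ≤ B_n(a)`** (`a ≥ 0`). [cite: JansevanRensburgWhittington2013, §3.1 eq. (3.9) (arXiv v4 p. 8: «c^{(d−1)}_{v*_n} l‡_{n−v*_n}(1) a^{v*_n+1} ≤ L_n(a)», the factor c^{(d−1)}_{v} a^{v})] -/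
theorem pow_le_Bw (n : ℕ) {a : ℝ} (ha : 0 ≤ a) : a ^ n ≤ AdsIrr.Bw n a := by
  have htraj : ∀ i ≤ n, traj (List.replicate n (1 : Step)) i = ![0, (i : ℤ)] := by
    intro i hi
    rw [traj, List.take_replicate, min_eq_left hi]
    induction i with
    | zero => simp; funext t; fin_cases t <;> rfl
    | succ i ih =>
      rw [List.replicate_succ, wEnd_cons, ih (by omega)]
      funext t; fin_cases t
      · simp [Step.vec, Step.dx, Step.dy]
      · simp [Step.vec, Step.dx, Step.dy]; ring
  have hend : wEnd (List.replicate n (1 : Step)) = ![0, (n : ℤ)] := by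
    rw [← traj_length, List.length_replicate, htraj n le_rfl]
  have hmem : List.replicate n (1 : Step) ∈ AdsIrr.wxbWords n := by
    rw [AdsIrr.mem_wxbWords]
    refine ⟨List.length_replicate, ?_, fun i hi => ?_, ?_, fun i hi => ?_, fun i hi => ?_⟩
    · rw [isSAW_iff_injOn]; intro i hi j hj hij
      simp only [Set.mem_setOf_eq, List.length_replicate] at hi hj
      rw [htraj i hi, htraj j hj] at hij
      have := congrFun hij 1; simp at this; exact this
    · rw [List.length_replicate] at hi; rw [htraj i hi]; simp
    · rw [hend]; simp
    · rw [List.length_replicate] at hi; rw [htraj i hi]; simp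
    · rw [List.length_replicate] at hi; rw [htraj i hi.le, hend]; simp; exact_mod_cast hi
  have hvis : AdsIrr.visits (List.replicate n (1 : Step)) = n := by
    rw [AdsIrr.visits, List.length_replicate]
    have hterm : ∀ j ∈ Finset.range n,
        (if traj (List.replicate n (1 : Step)) (j + 1) 0 = 0 then (1 : ℕ) else 0) = 1 := by
      intro j hj
      rw [Finset.mem_range] at hj
      rw [htraj (j + 1) (by omega)]
      simp
    rw [Finset.sum_congr rfl hterm]
    simp
  calc a ^ n = a ^ AdsIrr.visits (List.replicate n (1 : Step)) := by rw [hvis]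
    _ ≤ AdsIrr.Bw n a := Finset.single_le_sum (fun _ _ => pow_nonneg ha _) hmem

/-- **Eq. (3.9) for `d = 2`: `a^{v+2} · B_m(1) ≤ B_{v+m+4}(a)`** (`a ≥ 0`) — `v` steps along the wall (`c^{(1)}_v = 1` unfolded
walk IN the surface `ℤ¹`, weight `a^v`) followed by the lift of an unfolded loop of length `m` at `a = 1` (two visits).
[cite: JansevanRensburgWhittington2013, §3.1 eq. (3.9) (arXiv v4 p. 8: «c^{(d−1)}_{v*_n} l‡_{n−v*_n}(1) a^{v*_n+1} ≤ L_n(a)»)] -/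
theorem pow_mul_Bw_one_le_Bw (v m : ℕ) {a : ℝ} (ha : 0 ≤ a) :
    a ^ (v + 2) * AdsIrr.Bw m 1 ≤ AdsIrr.Bw (v + (m + 4)) a := by
  calc a ^ (v + 2) * AdsIrr.Bw m 1 = a ^ v * (a ^ 2 * AdsIrr.Bw m 1) := by ring
    _ ≤ AdsIrr.Bw v a * AdsIrr.Bw (m + 4) a :=
        mul_le_mul (pow_le_Bw v ha) (sq_mul_Bw_one_le_Bw m ha) (by positivity [AdsIrr.Bw_nonneg m zero_le_one])
          (AdsIrr.Bw_nonneg v ha)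
    _ ≤ AdsIrr.Bw (v + (m + 4)) a := AdsIrr.Bw_mul_le v (m + 4) ha

/-- **Lemma 3 for `d = 2` (`μ_1 = 1`), at every `α`, for the right derivative: `κ(α) − log μ ≥ (α − log μ) · d⁺κ/dα`**
(`κ ≥ max(log μ, α)` and `d⁺κ/dα ∈ [0, 1]`). [cite: JansevanRensburgWhittington2013, §3.1 Lemma 3 (arXiv v4 p. 8)] -/
theorem rightDensity_mul_sub_le (α : ℝ) :
    (α - Real.log (connectiveConstant 2)) * rightDensity α ≤ adsFreeEnergy α - Real.log (connectiveConstant 2) := by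
  have h0 := (leftDensity_nonneg α).trans (leftDensity_le_rightDensity α)
  have h1 := rightDensity_le_one α
  have hμ : Real.log (connectiveConstant 2) ≤ adsFreeEnergy α :=
    Real.log_le_log (connectiveConstant_pos 2) (connectiveConstant_le_adsRate (Real.exp_pos α).le)
  have hα : α ≤ adsFreeEnergy α := by
    have := Real.log_le_log (Real.exp_pos α) (self_le_adsRate (Real.exp_pos α).le)
    rwa [Real.log_exp] at this
  nlinarith

/-- **Lemma 3 for `d = 2`, left derivative: `κ(α) − log μ ≥ (α − log μ) · d⁻κ/dα`.**
[cite: JansevanRensburgWhittington2013, §3.1 Lemma 3 (arXiv v4 p. 8)] -/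
theorem leftDensity_mul_sub_le (α : ℝ) :
    (α - Real.log (connectiveConstant 2)) * leftDensity α ≤ adsFreeEnergy α - Real.log (connectiveConstant 2) := by
  have h0 := leftDensity_nonneg α
  have h1 := (leftDensity_le_rightDensity α).trans (rightDensity_le_one α)
  have hμ : Real.log (connectiveConstant 2) ≤ adsFreeEnergy α :=
    Real.log_le_log (connectiveConstant_pos 2) (connectiveConstant_le_adsRate (Real.exp_pos α).le)
  have hα : α ≤ adsFreeEnergy α := by
    have := Real.log_le_log (Real.exp_pos α) (self_le_adsRate (Real.exp_pos α).le)
    rwa [Real.log_exp] at this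
  nlinarith

/-- **Theorem 4 for `d = 2` (`μ_1 = 1`): the ratio `(κ(a) − log μ)/(log a − log μ)` is non-increasing in `a > μ`** — here from
`κ` `1`-Lipschitz and `κ(α) ≥ α`, at every pair `log μ < α ≤ β`.
[cite: JansevanRensburgWhittington2013, §3.1 Theorem 4 (arXiv v4 p. 8)] -/
theorem JansevanRensburgWhittington2013_thm4 {α β : ℝ} (hα : Real.log (connectiveConstant 2) < α) (hαβ : α ≤ β) :
    (adsFreeEnergy β - Real.log (connectiveConstant 2)) / (β - Real.log (connectiveConstant 2)) ≤
      (adsFreeEnergy α - Real.log (connectiveConstant 2)) / (α - Real.log (connectiveConstant 2)) := by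
  set L := Real.log (connectiveConstant 2)
  have hL : 0 < α - L := sub_pos.2 hα
  have hL' : 0 < β - L := by linarith
  have hlip := (adsFreeEnergy_sub_mem_Icc_of_le hαβ).2
  have hαle : α ≤ adsFreeEnergy α := by
    have := Real.log_le_log (Real.exp_pos α) (self_le_adsRate (Real.exp_pos α).le)
    rwa [Real.log_exp] at this
  rw [div_le_div_iff₀ hL' hL]
  nlinarith

/-- **Corollary 1 for `d = 2` (`μ_1 = 1`): for every `δ > 0` there is `α_δ` with `α ≤ κ(α) ≤ (1+δ) α` for all `α > α_δ`.**
[cite: JansevanRensburgWhittington2013, §3.1 Corollary 1 (arXiv v4 p. 9)] -/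
theorem JansevanRensburgWhittington2013_cor1 {δ : ℝ} (hδ : 0 < δ) :
    ∃ αδ : ℝ, ∀ α > αδ, α ≤ adsFreeEnergy α ∧ adsFreeEnergy α ≤ (1 + δ) * α := by
  refine ⟨max 0 (Real.log (connectiveConstant 2) / δ), fun α hα => ?_⟩
  have hα0 : 0 < α := lt_of_le_of_lt (le_max_left _ _) hα
  have hα1 : Real.log (connectiveConstant 2) / δ < α := lt_of_le_of_lt (le_max_right _ _) hα
  refine ⟨le_trans (le_max_right _ _) (max_le_adsFreeEnergy hα0.le), ?_⟩
  have h := adsFreeEnergy_le hα0.le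
  rw [div_lt_iff₀ hδ] at hα1
  nlinarith

/-! ### Low temperature: the desorbed fraction `1 − 𝓔_±(a)` is of order exactly `a⁻²` -/

/-- **`1 − 33 e^{−2α} ≤ 𝓔_-(e^α)` for `α ≥ 1/2`** (chord from `α − 1/2`: `κ(α) ≥ α`, `κ(α − 1/2) ≤ α − 1/2 + 6e^{−2α+1}`, `12e ≤ 33`).
[cite: JansevanRensburgWhittington2013, §3.1 eq. (3.4) (arXiv v4 p. 6)] -/
theorem one_sub_le_leftDensity {α : ℝ} (hα : 1 / 2 ≤ α) : 1 - 33 * Real.exp (-2 * α) ≤ leftDensity α := by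
  have hlt : α - 1 / 2 < α := by linarith
  refine le_trans ?_ (slope_le_leftDensity hlt)
  rw [slope_def_field, sub_sub_cancel]
  have hup : adsFreeEnergy (α - 1 / 2) ≤ (α - 1 / 2) + 6 * Real.exp (-2 * (α - 1 / 2)) := by
    have := adsFreeEnergy_sub_le_six_mul_exp (show (0 : ℝ) ≤ α - 1 / 2 by linarith); linarith
  have hlo : α ≤ adsFreeEnergy α := by
    have := Real.log_le_log (Real.exp_pos α) (self_le_adsRate (Real.exp_pos α).le)
    rwa [Real.log_exp] at this
  have he : Real.exp (-2 * (α - 1 / 2)) = Real.exp 1 * Real.exp (-2 * α) := by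
    rw [← Real.exp_add]; ring_nf
  have he1 : Real.exp 1 ≤ 2.75 := (Real.exp_one_lt_d9).le.trans (by norm_num)
  have hpos : 0 < Real.exp (-2 * α) := Real.exp_pos _
  rw [le_div_iff₀ (by norm_num : (0 : ℝ) < 1 / 2)]
  nlinarith

/-- **`𝓔_+(e^α) ≤ 1 − e^{−2α}/16` for `α ≥ 0`** (chord to `α + 2`: `κ(α) ≥ α + e^{−2α}/4`, `κ(α+2) ≤ α + 2 + 6e^{−2α−4}`, `e⁴ ≥ 48`).
[cite: JansevanRensburgWhittington2013, §3.1 eq. (3.4) (arXiv v4 p. 6)] -/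
theorem rightDensity_le_one_sub {α : ℝ} (hα : 0 ≤ α) : rightDensity α ≤ 1 - Real.exp (-2 * α) / 16 := by
  have hlt : α < α + 2 := by linarith
  refine (rightDensity_le_slope hlt).trans ?_
  rw [slope_def_field, add_sub_cancel_left]
  have hup : adsFreeEnergy (α + 2) ≤ (α + 2) + 6 * Real.exp (-2 * (α + 2)) := by
    have := adsFreeEnergy_sub_le_six_mul_exp (show (0 : ℝ) ≤ α + 2 by linarith); linarith
  have hlo : α + Real.exp (-2 * α) / 4 ≤ adsFreeEnergy α := by
    have := exp_mul_le_adsFreeEnergy_sub hα; linarith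
  have he : Real.exp (-2 * (α + 2)) = Real.exp (-2 * α) * (Real.exp 1)⁻¹ ^ 4 := by
    rw [inv_pow, ← Real.exp_nat_mul, ← Real.exp_neg, ← Real.exp_add]; ring_nf
  have he1 : (Real.exp 1)⁻¹ ^ 4 ≤ 1 / 48 := by
    have h27 : (2.7 : ℝ) ≤ Real.exp 1 := by linarith [Real.exp_one_gt_d9]
    calc (Real.exp 1)⁻¹ ^ 4 ≤ (2.7 : ℝ)⁻¹ ^ 4 := by
          gcongr
        _ ≤ 1 / 48 := by norm_num
  have hpos : 0 < Real.exp (-2 * α) := Real.exp_pos _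
  rw [div_le_iff₀ (by norm_num : (0 : ℝ) < 2)]
  nlinarith

/-- **The desorbed fraction is `Θ(a⁻²)`: `e^{−2α}/16 ≤ 1 − 𝓔_+(e^α) ≤ 1 − 𝓔_-(e^α) ≤ 33 e^{−2α}` for `α ≥ 1/2`.**
[cite: JansevanRensburgWhittington2013, §3.1 eq. (3.4) (arXiv v4 p. 6)] -/
theorem one_sub_densities_window {α : ℝ} (hα : 1 / 2 ≤ α) :
    Real.exp (-2 * α) / 16 ≤ 1 - rightDensity α ∧ 1 - rightDensity α ≤ 1 - leftDensity α ∧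
      1 - leftDensity α ≤ 33 * Real.exp (-2 * α) := by
  refine ⟨?_, ?_, ?_⟩
  · have := rightDensity_le_one_sub (show (0 : ℝ) ≤ α by linarith); linarith
  · linarith [leftDensity_le_rightDensity α]
  · linarith [one_sub_le_leftDensity hα]

/-- **`𝓔_+(e^α) → 1` as `α → ∞`.** [cite: JansevanRensburgWhittington2013, §3.1 Corollary 1 (arXiv v4 p. 9: κ(a) ∼ log μ_{d−1} + log a)] -/
theorem tendsto_rightDensity_atTop : Tendsto rightDensity atTop (𝓝 1) := by
  have h0 : Tendsto (fun α : ℝ => 1 - 33 * Real.exp (-2 * α)) atTop (𝓝 1) := by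
    have h : Tendsto (fun α : ℝ => Real.exp (-2 * α)) atTop (𝓝 0) := by
      have := Real.tendsto_exp_neg_atTop_nhds_zero.comp (tendsto_id.const_mul_atTop (show (0:ℝ) < 2 by norm_num))
      refine this.congr fun α => ?_
      simp only [Function.comp, id]; ring_nf
    simpa using (tendsto_const_nhds (x := (1 : ℝ))).sub (h.const_mul 33)
  refine tendsto_of_tendsto_of_tendsto_of_le_of_le' h0 tendsto_const_nhds ?_ ?_
  · filter_upwards [eventually_ge_atTop (1 / 2 : ℝ)] with α hα
    exact (one_sub_le_leftDensity hα).trans (leftDensity_le_rightDensity α)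
  · exact Eventually.of_forall rightDensity_le_one

/-- **`𝓔_-(e^α) → 1` as `α → ∞`.** [cite: JansevanRensburgWhittington2013, §3.1 Corollary 1 (arXiv v4 p. 9: κ(a) ∼ log μ_{d−1} + log a)] -/
theorem tendsto_leftDensity_atTop : Tendsto leftDensity atTop (𝓝 1) := by
  have h0 : Tendsto (fun α : ℝ => 1 - 33 * Real.exp (-2 * α)) atTop (𝓝 1) := by
    have h : Tendsto (fun α : ℝ => Real.exp (-2 * α)) atTop (𝓝 0) := by
      have := Real.tendsto_exp_neg_atTop_nhds_zero.comp (tendsto_id.const_mul_atTop (show (0:ℝ) < 2 by norm_num))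
      refine this.congr fun α => ?_
      simp only [Function.comp, id]; ring_nf
    simpa using (tendsto_const_nhds (x := (1 : ℝ))).sub (h.const_mul 33)
  refine tendsto_of_tendsto_of_tendsto_of_le_of_le' h0 tendsto_const_nhds ?_ ?_
  · filter_upwards [eventually_ge_atTop (1 / 2 : ℝ)] with α hα
    exact one_sub_le_leftDensity hα
  · exact Eventually.of_forall fun α => (leftDensity_le_rightDensity α).trans (rightDensity_le_one α)

/-- **Eventually in `n`, at fugacity `a ≥ 2`: `1 − 34/a² ≤ n⁻¹⟨v⟩_n(a) ≤ 1 − 1/(17a²)`** — almost all monomers adsorbed,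
but a fraction of order `a⁻²` stays off the wall. [cite: JansevanRensburgWhittington2013, §3.1 Theorem 3 (arXiv v4 p. 7)] -/
theorem eventually_visitDensity_window {a : ℝ} (ha : 2 ≤ a) :
    ∀ᶠ n : ℕ in atTop, 1 - 34 / a ^ 2 ≤ visitDensity n a ∧ visitDensity n a ≤ 1 - 1 / (17 * a ^ 2) := by
  have ha0 : 0 < a := by linarith
  have hα : 1 / 2 ≤ Real.log a :=
    le_trans (by linarith [Real.log_two_gt_d9]) (Real.log_le_log two_pos ha)
  have he : Real.exp (-2 * Real.log a) = 1 / a ^ 2 := by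
    rw [show -2 * Real.log a = -(2 * Real.log a) by ring, Real.exp_neg, ← Real.log_rpow ha0, Real.exp_log (by positivity),
      Real.rpow_two, one_div]
  have hε : 0 < 1 / a ^ 2 := by positivity
  have h1 := eventually_le_visitDensity (Real.log a) hε
  have h2 := eventually_visitDensity_le (Real.log a) (show 0 < 1 / (272 * a ^ 2) by positivity)
  rw [Real.exp_log ha0] at h1 h2
  filter_upwards [h1, h2] with n hn1 hn2
  have hlo := one_sub_le_leftDensity hα
  have hup := rightDensity_le_one_sub (show (0 : ℝ) ≤ Real.log a by linarith)
  rw [he] at hlo hup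
  constructor
  · have : 1 - 34 / a ^ 2 = (1 - 33 * (1 / a ^ 2)) - 1 / a ^ 2 := by ring
    linarith
  · have : 1 - 1 / (17 * a ^ 2) = (1 - (1 / a ^ 2) / 16) + 1 / (272 * a ^ 2) := by field_simp; ring
    linarith

/-! ### Low temperature, sharp: `a²(1 − 𝓔_±(a)) → 2` -/

/-- Lower comparison function `Φ(s)/(1 + s⁵Φ(s))`, `Φ(s) = ((2+s)/(1+s)² − 6s/(1+s)³)/(1 + s⁴/(1+s)² + 6s⁶/(1+s)³)`
(`s = a^{−1/2}`): the chord from `a` to `a(1+s)` evaluated on the window `a + 1/a ≤ e^κ ≤ a + 1/a + 6/a²`. [cite: JansevanRensburgWhittington2013, §3.1 eq. (3.4) (arXiv v4 p. 6)] -/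
def lowPhi (s : ℝ) : ℝ :=
  ((2 + s) / (1 + s) ^ 2 - 6 * s / (1 + s) ^ 3) / (1 + s ^ 4 / (1 + s) ^ 2 + 6 * s ^ 6 / (1 + s) ^ 3)

/-- Upper comparison function `(2 + s + 6s(1+s)³)(1+s)/(1+s⁴)` (chord from `a/(1+s)` to `a`). [cite: JansevanRensburgWhittington2013, §3.1 eq. (3.4) (arXiv v4 p. 6)] -/
def upPhi (s : ℝ) : ℝ := (2 + s + 6 * s * (1 + s) ^ 3) * (1 + s) / (1 + s ^ 4)

/-- `Φ(s) → 2` as `s → 0` (a rational function continuous at `0`). [cite: JansevanRensburgWhittington2013, §3.1 eq. (3.4) (arXiv v4 p. 6)] -/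
theorem tendsto_lowPhi : Tendsto lowPhi (𝓝 0) (𝓝 2) := by
  have hc : ContinuousAt lowPhi 0 := by
    unfold lowPhi
    refine ContinuousAt.div ?_ ?_ (by norm_num)
    · refine ContinuousAt.sub ?_ ?_
      · exact ContinuousAt.div (by fun_prop) (by fun_prop) (by norm_num)
      · exact ContinuousAt.div (by fun_prop) (by fun_prop) (by norm_num)
    · refine ContinuousAt.add (ContinuousAt.add continuousAt_const ?_) ?_
      · exact ContinuousAt.div (by fun_prop) (by fun_prop) (by norm_num)
      · exact ContinuousAt.div (by fun_prop) (by fun_prop) (by norm_num)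
  have := hc.tendsto
  rwa [show lowPhi 0 = 2 by norm_num [lowPhi]] at this

/-- `(2 + s + 6s(1+s)³)(1+s)/(1+s⁴) → 2` as `s → 0`. [cite: JansevanRensburgWhittington2013, §3.1 eq. (3.4) (arXiv v4 p. 6)] -/
theorem tendsto_upPhi : Tendsto upPhi (𝓝 0) (𝓝 2) := by
  have hc : ContinuousAt upPhi 0 := by
    unfold upPhi
    exact ContinuousAt.div (by fun_prop) (by fun_prop) (by norm_num)
  have := hc.tendsto
  rwa [show upPhi 0 = 2 by norm_num [upPhi]] at this

/-- `log (1 + w) ≥ w/(1+w)` for `w > -1`. [folklore] -/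
private theorem div_le_log_one_add {w : ℝ} (hw : 0 < 1 + w) : w / (1 + w) ≤ Real.log (1 + w) := by
  have := Real.one_sub_inv_le_log_of_pos hw
  rwa [show 1 - (1 + w)⁻¹ = w / (1 + w) by field_simp; ring] at this

/-- `log (1 + w) ≤ w` for `w > -1`. [folklore] -/
private theorem log_one_add_le {w : ℝ} (hw : 0 < 1 + w) : Real.log (1 + w) ≤ w := by
  have := Real.log_le_sub_one_of_pos hw; linarith

/-- **Chord bound above `α` on the `EXACT` window: `Φ(s)/(1 + s⁵Φ(s)) ≤ e^{2α}(1 − 𝓔_+(e^α))`, `s = e^{−α/2}`, for `e^α ≥ 36`.**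
[cite: JansevanRensburgWhittington2013, §3.1 eq. (3.4) (arXiv v4 p. 6)] -/
theorem lowPhi_le_exp_mul_one_sub_rightDensity {α : ℝ} (hα : Real.log 36 ≤ α) :
    lowPhi (Real.exp (-α / 2)) / (1 + Real.exp (-α / 2) ^ 5 * lowPhi (Real.exp (-α / 2))) ≤
      Real.exp (2 * α) * (1 - rightDensity α) := by
  set s := Real.exp (-α / 2) with hs_def
  set a := Real.exp α with ha_def
  have hs : 0 < s := Real.exp_pos _
  have ha36 : 36 ≤ a := by
    rw [ha_def, ← Real.exp_log (by norm_num : (0:ℝ) < 36)]; exact Real.exp_le_exp.2 hα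
  have ha0 : 0 < a := by linarith
  have has : a = 1 / s ^ 2 := by
    rw [hs_def, ha_def, ← Real.exp_nat_mul, one_div, ← Real.exp_neg]; ring_nf
  have hs2 : s ^ 2 = 1 / a := by rw [has]; field_simp
  have hs6 : s ≤ 1 / 6 := by
    have h1 : s ^ 2 ≤ (1 / 6) ^ 2 := by
      rw [hs2, div_le_iff₀ ha0]; nlinarith
    nlinarith [h1]
  have hs1 : s < 1 := by linarith
  -- the two points `a` and `b = a(1+s)`; `h = log(1+s)`
  set b := a * (1 + s) with hb_def
  have hb6 : 6 ≤ b := by rw [hb_def]; nlinarith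
  have hb0 : 0 < b := by linarith
  have hh : 0 < Real.log (1 + s) := Real.log_pos (by linarith)
  have hβ : Real.exp (α + Real.log (1 + s)) = b := by
    rw [Real.exp_add, Real.exp_log (by linarith), hb_def]
  -- the window
  have hRa : a + 1 / a ≤ adsRate a := (adsRate_mem_Icc_exact (by linarith)).1
  have hRb : adsRate b ≤ b + 1 / b + 6 / b ^ 2 := (adsRate_mem_Icc_exact hb6).2
  -- slope bound: `rightDensity α ≤ (κ(α+h) − κ(α))/h`
  have hslope := rightDensity_le_slope (lt_add_of_pos_right α hh)
  rw [slope_def_field, add_sub_cancel_left] at hslope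
  have hκb : adsFreeEnergy (α + Real.log (1 + s)) ≤ Real.log (b + 1 / b + 6 / b ^ 2) := by
    rw [adsFreeEnergy, hβ]; exact Real.log_le_log (adsRate_pos hb0.le) hRb
  have hκa : Real.log (a + 1 / a) ≤ adsFreeEnergy α := by
    rw [adsFreeEnergy, ← ha_def]; exact Real.log_le_log (by positivity) hRa
  -- `W = s⁵ Φ(s)` is the relative gap of the window endpoints
  have hW_def : (1 + s) * (a + 1 / a) / (b + 1 / b + 6 / b ^ 2) = 1 + s ^ 5 * lowPhi s := by
    rw [hb_def, has, lowPhi]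
    field_simp
    ring
  have hPhi : 0 < lowPhi s := by
    rw [lowPhi]
    apply div_pos _ (by positivity)
    rw [div_sub_div _ _ (by positivity) (by positivity)]
    apply div_pos _ (by positivity)
    have h1 : 0 < (1 - s) * (2 - s) := mul_pos (by linarith) (by linarith)
    nlinarith [mul_pos (pow_pos (show (0:ℝ) < 1 + s by linarith) 2) h1]
  have hW : 0 < s ^ 5 * lowPhi s := by positivity
  have hlogW : Real.log (1 + s ^ 5 * lowPhi s) =
      Real.log (a + 1 / a) + Real.log (1 + s) - Real.log (b + 1 / b + 6 / b ^ 2) := by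
    rw [← hW_def, Real.log_div (by positivity) (by positivity), Real.log_mul (by positivity) (by positivity)]; ring
  have key : Real.log (1 + s ^ 5 * lowPhi s) / Real.log (1 + s) ≤ 1 - rightDensity α := by
    rw [div_le_iff₀ hh, hlogW]
    have := mul_le_mul_of_nonneg_right hslope hh.le
    rw [div_mul_cancel₀ _ hh.ne'] at this
    nlinarith
  -- lower the left side: `log(1+W) ≥ W/(1+W)`, `log(1+s) ≤ s`
  have hlow : lowPhi s / (1 + s ^ 5 * lowPhi s) * s ^ 4 ≤ Real.log (1 + s ^ 5 * lowPhi s) / Real.log (1 + s) := by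
    rw [le_div_iff₀ hh]
    have h1 := div_le_log_one_add (show 0 < 1 + s ^ 5 * lowPhi s by linarith)
    have h2 := log_one_add_le (show 0 < 1 + s by linarith)
    have h3 : 0 ≤ lowPhi s / (1 + s ^ 5 * lowPhi s) * s ^ 4 :=
      mul_nonneg (div_nonneg hPhi.le (by linarith)) (by positivity)
    calc lowPhi s / (1 + s ^ 5 * lowPhi s) * s ^ 4 * Real.log (1 + s)
        ≤ lowPhi s / (1 + s ^ 5 * lowPhi s) * s ^ 4 * s := mul_le_mul_of_nonneg_left h2 h3
      _ = s ^ 5 * lowPhi s / (1 + s ^ 5 * lowPhi s) := by ring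
      _ ≤ Real.log (1 + s ^ 5 * lowPhi s) := h1
  have he2 : Real.exp (2 * α) = 1 / s ^ 4 := by
    rw [hs_def, ← Real.exp_nat_mul, one_div, ← Real.exp_neg]; ring_nf
  rw [he2, one_div, inv_mul_eq_div, le_div_iff₀ (pow_pos hs 4)]
  exact hlow.trans key

/-- **Chord bound below `α` on the `EXACT` window: `e^{2α}(1 − 𝓔_-(e^α)) ≤ (2 + s + 6s(1+s)³)(1+s)/(1+s⁴)`, `s = e^{−α/2}`,
for `e^α ≥ 36`.** [cite: JansevanRensburgWhittington2013, §3.1 eq. (3.4) (arXiv v4 p. 6)] -/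
theorem exp_mul_one_sub_leftDensity_le_upPhi {α : ℝ} (hα : Real.log 36 ≤ α) :
    Real.exp (2 * α) * (1 - leftDensity α) ≤ upPhi (Real.exp (-α / 2)) := by
  set s := Real.exp (-α / 2) with hs_def
  set a := Real.exp α with ha_def
  have hs : 0 < s := Real.exp_pos _
  have ha36 : 36 ≤ a := by
    rw [ha_def, ← Real.exp_log (by norm_num : (0:ℝ) < 36)]; exact Real.exp_le_exp.2 hα
  have ha0 : 0 < a := by linarith
  have has : a = 1 / s ^ 2 := by
    rw [hs_def, ha_def, ← Real.exp_nat_mul, one_div, ← Real.exp_neg]; ring_nf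
  have hs2 : s ^ 2 = 1 / a := by rw [has]; field_simp
  have hs6 : s ≤ 1 / 6 := by
    have h1 : s ^ 2 ≤ (1 / 6) ^ 2 := by
      rw [hs2, div_le_iff₀ ha0]; nlinarith
    nlinarith [h1]
  have hs1 : s < 1 := by linarith
  -- the two points `c = a/(1+s)` and `a`; `h = log(1+s)`
  set c := a / (1 + s) with hc_def
  have h1s : 0 < 1 + s := by linarith
  have hc6 : 6 ≤ c := by rw [hc_def, le_div_iff₀ h1s]; nlinarith
  have hc0 : 0 < c := by linarith
  have hh : 0 < Real.log (1 + s) := Real.log_pos (by linarith)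
  have hγ : Real.exp (α - Real.log (1 + s)) = c := by
    rw [Real.exp_sub, Real.exp_log h1s, hc_def]
  -- the window: lower end at `a`, upper end at `c`
  have hRa : a + 1 / a ≤ adsRate a := (adsRate_mem_Icc_exact (by linarith)).1
  have hRc : adsRate c ≤ c + 1 / c + 6 / c ^ 2 := (adsRate_mem_Icc_exact hc6).2
  have hslope := slope_le_leftDensity (sub_lt_self α hh)
  rw [slope_def_field, sub_sub_cancel] at hslope
  have hκc : adsFreeEnergy (α - Real.log (1 + s)) ≤ Real.log (c + 1 / c + 6 / c ^ 2) := by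
    rw [adsFreeEnergy, hγ]; exact Real.log_le_log (adsRate_pos hc0.le) hRc
  have hκa : Real.log (a + 1 / a) ≤ adsFreeEnergy α := by
    rw [adsFreeEnergy, ← ha_def]; exact Real.log_le_log (by positivity) hRa
  -- `W = s⁵ V(s)/(1+s)·…`: the relative gap of the window endpoints
  have hW_def : (1 + s) * (c + 1 / c + 6 / c ^ 2) / (a + 1 / a) = 1 + s ^ 5 * upPhi s / (1 + s) := by
    rw [hc_def, has, upPhi]
    field_simp
    ring
  have hV : 0 < upPhi s := by rw [upPhi]; positivity
  have hW : 0 < s ^ 5 * upPhi s / (1 + s) := by positivity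
  have hlogW : Real.log (1 + s ^ 5 * upPhi s / (1 + s)) =
      Real.log (1 + s) + Real.log (c + 1 / c + 6 / c ^ 2) - Real.log (a + 1 / a) := by
    rw [← hW_def, Real.log_div (by positivity) (by positivity), Real.log_mul (by positivity) (by positivity)]
  have key : 1 - leftDensity α ≤ Real.log (1 + s ^ 5 * upPhi s / (1 + s)) / Real.log (1 + s) := by
    rw [le_div_iff₀ hh, hlogW]
    have := mul_le_mul_of_nonneg_right hslope hh.le
    rw [div_mul_cancel₀ _ hh.ne'] at this
    nlinarith
  -- raise the right side: `log(1+W) ≤ W`, `log(1+s) ≥ s/(1+s)`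
  have hup : Real.log (1 + s ^ 5 * upPhi s / (1 + s)) / Real.log (1 + s) ≤ s ^ 4 * upPhi s := by
    rw [div_le_iff₀ hh]
    have h1 := log_one_add_le (show 0 < 1 + s ^ 5 * upPhi s / (1 + s) by linarith)
    have h2 := div_le_log_one_add (show 0 < 1 + s by linarith)
    calc Real.log (1 + s ^ 5 * upPhi s / (1 + s)) ≤ s ^ 5 * upPhi s / (1 + s) := h1
      _ = s ^ 4 * upPhi s * (s / (1 + s)) := by field_simp
      _ ≤ s ^ 4 * upPhi s * Real.log (1 + s) := mul_le_mul_of_nonneg_left h2 (by positivity)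
  have he2 : Real.exp (2 * α) = 1 / s ^ 4 := by
    rw [hs_def, ← Real.exp_nat_mul, one_div, ← Real.exp_neg]; ring_nf
  rw [he2]
  calc 1 / s ^ 4 * (1 - leftDensity α) ≤ 1 / s ^ 4 * (s ^ 4 * upPhi s) :=
        mul_le_mul_of_nonneg_left (key.trans hup) (by positivity)
    _ = upPhi s := by field_simp

/-- **`e^{2α}(1 − d⁺κ/dα) → 2` as `α → ∞`: `𝓔_+(a) = 1 − 2/a² + o(a⁻²)`.** (Squeeze between the two chord bounds on the window
`a + 1/a ≤ e^{κ(a)} ≤ a + 1/a + 6/a²` of `SAWAdsorptionLowTemperatureExact.lean`, with `s = a^{−1/2} → 0`.)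
[cite: JansevanRensburgWhittington2013, §3.1 eq. (3.4) (arXiv v4 p. 6)] -/
theorem tendsto_exp_mul_one_sub_rightDensity :
    Tendsto (fun α : ℝ => Real.exp (2 * α) * (1 - rightDensity α)) atTop (𝓝 2) := by
  have hs : Tendsto (fun α : ℝ => Real.exp (-α / 2)) atTop (𝓝 0) := by
    have := Real.tendsto_exp_neg_atTop_nhds_zero.comp (tendsto_id.atTop_mul_const (show (0:ℝ) < 1 / 2 by norm_num))
    refine this.congr fun α => ?_
    simp only [Function.comp, id]; ring_nf
  have hlow : Tendsto (fun α : ℝ => lowPhi (Real.exp (-α / 2)) / (1 + Real.exp (-α / 2) ^ 5 * lowPhi (Real.exp (-α / 2))))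
      atTop (𝓝 2) := by
    have h1 := tendsto_lowPhi.comp hs
    have h2 : Tendsto (fun α : ℝ => 1 + Real.exp (-α / 2) ^ 5 * lowPhi (Real.exp (-α / 2))) atTop (𝓝 1) := by
      simpa using (tendsto_const_nhds (x := (1:ℝ))).add ((hs.pow 5).mul h1)
    have h3 := h1.div h2 one_ne_zero
    rw [div_one] at h3
    exact h3
  have hup : Tendsto (fun α : ℝ => upPhi (Real.exp (-α / 2))) atTop (𝓝 2) := tendsto_upPhi.comp hs
  have hup' : Tendsto (fun α : ℝ => Real.exp (2 * α) * (1 - leftDensity α)) atTop (𝓝 2) := by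
    refine tendsto_of_tendsto_of_tendsto_of_le_of_le' hlow hup ?_ ?_
    · filter_upwards [eventually_ge_atTop (Real.log 36)] with α hα
      exact (lowPhi_le_exp_mul_one_sub_rightDensity hα).trans
        (mul_le_mul_of_nonneg_left (by linarith [leftDensity_le_rightDensity α]) (Real.exp_pos _).le)
    · filter_upwards [eventually_ge_atTop (Real.log 36)] with α hα
      exact exp_mul_one_sub_leftDensity_le_upPhi hα
  refine tendsto_of_tendsto_of_tendsto_of_le_of_le' hlow hup' ?_ ?_
  · filter_upwards [eventually_ge_atTop (Real.log 36)] with α hα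
    exact lowPhi_le_exp_mul_one_sub_rightDensity hα
  · filter_upwards with α
    exact mul_le_mul_of_nonneg_left (by linarith [leftDensity_le_rightDensity α]) (Real.exp_pos _).le

/-- **`e^{2α}(1 − d⁻κ/dα) → 2` as `α → ∞`: `𝓔_-(a) = 1 − 2/a² + o(a⁻²)`.** [cite: JansevanRensburgWhittington2013, §3.1 eq. (3.4) (arXiv v4 p. 6)] -/
theorem tendsto_exp_mul_one_sub_leftDensity :
    Tendsto (fun α : ℝ => Real.exp (2 * α) * (1 - leftDensity α)) atTop (𝓝 2) := by
  have hs : Tendsto (fun α : ℝ => Real.exp (-α / 2)) atTop (𝓝 0) := by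
    have := Real.tendsto_exp_neg_atTop_nhds_zero.comp (tendsto_id.atTop_mul_const (show (0:ℝ) < 1 / 2 by norm_num))
    refine this.congr fun α => ?_
    simp only [Function.comp, id]; ring_nf
  have hlow : Tendsto (fun α : ℝ => lowPhi (Real.exp (-α / 2)) / (1 + Real.exp (-α / 2) ^ 5 * lowPhi (Real.exp (-α / 2))))
      atTop (𝓝 2) := by
    have h1 := tendsto_lowPhi.comp hs
    have h2 : Tendsto (fun α : ℝ => 1 + Real.exp (-α / 2) ^ 5 * lowPhi (Real.exp (-α / 2))) atTop (𝓝 1) := by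
      simpa using (tendsto_const_nhds (x := (1:ℝ))).add ((hs.pow 5).mul h1)
    have h3 := h1.div h2 one_ne_zero
    rw [div_one] at h3
    exact h3
  have hup : Tendsto (fun α : ℝ => upPhi (Real.exp (-α / 2))) atTop (𝓝 2) := tendsto_upPhi.comp hs
  refine tendsto_of_tendsto_of_tendsto_of_le_of_le' hlow hup ?_ ?_
  · filter_upwards [eventually_ge_atTop (Real.log 36)] with α hα
    exact (lowPhi_le_exp_mul_one_sub_rightDensity hα).trans
      (mul_le_mul_of_nonneg_left (by linarith [leftDensity_le_rightDensity α]) (Real.exp_pos _).le)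
  · filter_upwards [eventually_ge_atTop (Real.log 36)] with α hα
    exact exp_mul_one_sub_leftDensity_le_upPhi hα

/-- **In the fugacity: `a² (1 − 𝓔_+(a)) → 2` as `a → ∞`** — the fraction of monomers OFF the wall at low temperature is
`2/a² + o(a⁻²)`. [cite: JansevanRensburgWhittington2013, §3.1 eq. (3.4) (arXiv v4 p. 6)] -/
theorem tendsto_sq_mul_one_sub_rightDensity_log :
    Tendsto (fun a : ℝ => a ^ 2 * (1 - rightDensity (Real.log a))) atTop (𝓝 2) := by
  refine ((tendsto_exp_mul_one_sub_rightDensity.comp Real.tendsto_log_atTop).congr' ?_)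
  filter_upwards [eventually_gt_atTop 0] with a ha
  simp only [Function.comp]
  rw [show (2 : ℝ) * Real.log a = ((2 : ℕ) : ℝ) * Real.log a by norm_num, ← Real.log_pow, Real.exp_log (pow_pos ha 2)]

/-- **In the fugacity: `a² (1 − 𝓔_-(a)) → 2` as `a → ∞`.** [cite: JansevanRensburgWhittington2013, §3.1 eq. (3.4) (arXiv v4 p. 6)] -/
theorem tendsto_sq_mul_one_sub_leftDensity_log :
    Tendsto (fun a : ℝ => a ^ 2 * (1 - leftDensity (Real.log a))) atTop (𝓝 2) := by
  refine ((tendsto_exp_mul_one_sub_leftDensity.comp Real.tendsto_log_atTop).congr' ?_)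
  filter_upwards [eventually_gt_atTop 0] with a ha
  simp only [Function.comp]
  rw [show (2 : ℝ) * Real.log a = ((2 : ℕ) : ℝ) * Real.log a by norm_num, ← Real.log_pow, Real.exp_log (pow_pos ha 2)]

end Literature.Probability.RandomPlanarGeometry.SAW.Zd
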